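import Mathlib
import Summits.QuantumAdvantage.QuantumAdvantage.Theorems.MobiusLadderWalshLiouvilleBound
import Literature.Computability.MetaComplexity.SmolenskyRows
import Literature.Probability.RandomGraphs.LowDegree

/-!
# Bourgain's Möbius–Walsh bound for `λ` on the cube

Bourgain's Möbius–Walsh bound for the Liouville function (the PROVED route item
`WalshLiouvilleBound`, discharged by
`Summit.QuantumAdvantage.QuantumAdvantage.Theorems.MobiusLadder.walshLiouvilleBound_proof`)
transported from the range/`testBit` form

  `|Σ_{N < 2ⁿ} λ(N) · w_S(bits N)| ≤ 2^{n − n^c}`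

to the cube form

  `|Σ_{b ∈ {0,1}ⁿ} λ(val b) · w_S(b)| ≤ 2^{n − n^c}`,   `val b = boolFunEquivFin n b`.

The two sums are equal: reindex `N = val b` through the enumeration
`boolFunEquivFin n : (Fin n → Bool) ≃ Fin (2ⁿ)` (`Fin.sum_univ_eq_sum_range`, `Equiv.sum_comp`),
and the digits of `val b` are `b` (`Smolensky.testBit_boolFunEquivFin`).

Wave-2 support of line Sketch/LAR (LAR at level 1), crux stmt-QuantumAdvantage-1392.
-/

namespace Summit.QuantumAdvantage.DigitPolyUniformity.SketchLAR

open Filter Finset Module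
open Literature.Computability.MetaComplexity (boolFunEquivFin)
open Literature.Probability.RandomGraphs.LowDegree (walsh)

namespace WalshCubeBound

/-- **The digits of `val b` are `b`**: the bit vector of `boolFunEquivFin n b` is `b` itself.
[folklore] -/
theorem digits_eq {n : ℕ} (b : Fin n → Bool) :
    (fun i : Fin n => Nat.testBit ((boolFunEquivFin n b : Fin (2 ^ n)) : ℕ) i) = b := by
  funext i
  exact Literature.Computability.MetaComplexity.Smolensky.testBit_boolFunEquivFin b i

/-- **Reindexing the Walsh–Liouville sum over the cube.** For every `S ⊆ {0,…,n-1}`,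
`Σ_{b ∈ {0,1}ⁿ} λ(val b) · w_S(b) = Σ_{N < 2ⁿ} λ(N) · w_S(bits N)` (substitute `N = val b`, a
bijection `{0,1}ⁿ ≃ {0,…,2ⁿ-1}` whose digits are `b`). [folklore] -/
theorem sum_cube_eq_sum_range (n : ℕ) (S : Finset (Fin n)) :
    ∑ b : Fin n → Bool,
        ((ArithmeticFunction.liouville ((boolFunEquivFin n b : Fin (2 ^ n)) : ℕ) : ℤ) : ℝ) *
          walsh S b =
      ∑ N ∈ range (2 ^ n), ((ArithmeticFunction.liouville N : ℤ) : ℝ) *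
        walsh S (fun i : Fin n => Nat.testBit N i) := by
  -- the range summand as a function of `N`
  set g : ℕ → ℝ := fun N => ((ArithmeticFunction.liouville N : ℤ) : ℝ) *
      walsh S (fun i : Fin n => Nat.testBit N i) with hg
  have h1 : ∑ N ∈ range (2 ^ n), g N =
      ∑ b : Fin n → Bool, g ((boolFunEquivFin n b : Fin (2 ^ n)) : ℕ) := by
    rw [← Fin.sum_univ_eq_sum_range]
    exact (Equiv.sum_comp (boolFunEquivFin n) (fun k : Fin (2 ^ n) => g (k : ℕ))).symm
  rw [h1]
  refine Finset.sum_congr rfl fun b _ => ?_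
  simp only [hg]
  rw [digits_eq b]

end WalshCubeBound

/-- **W4: Bourgain's Walsh bound for `λ` in cube form.** There is `c > 0` such that for all
sufficiently large `n` and every `S : Finset (Fin n)`,
`|Σ_{b ∈ {0,1}ⁿ} λ(val b) · walsh S b| ≤ 2^{n − n^c}`, where `val b = boolFunEquivFin n b`.
Transport of the PROVED route item `WalshLiouvilleBound`
(`walshLiouvilleBound_proof`; Bourgain 2013, Theorem 1, Liouville form) along the reindexing
`WalshCubeBound.sum_cube_eq_sum_range`. -/
theorem stub_walsh_cube_bound :
    ∃ c : ℝ, 0 < c ∧ ∀ᶠ n : ℕ in atTop, ∀ S : Finset (Fin n),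
      |∑ b : Fin n → Bool, ((ArithmeticFunction.liouville ((boolFunEquivFin n b : Fin (2 ^ n)) : ℕ) : ℤ) : ℝ) *
          walsh S b| ≤ (2 : ℝ) ^ ((n : ℝ) - (n : ℝ) ^ c) := by
  have h : Summit.QuantumAdvantage.QuantumAdvantage.Theses.MobiusLadder.WalshLiouvilleBound :=
    Summit.QuantumAdvantage.QuantumAdvantage.Theorems.MobiusLadder.walshLiouvilleBound_proof
  obtain ⟨c, hc, hev⟩ := h
  refine ⟨c, hc, hev.mono fun n hn S => ?_⟩
  rw [WalshCubeBound.sum_cube_eq_sum_range n S]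
  exact hn S

end Summit.QuantumAdvantage.DigitPolyUniformity.SketchLAR
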